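import Summits.AtomisticToContinuum.BoseEinsteinCondensation.Theorems.BECGroundStateSOSPeriodicIRBoundFsumDCAdjoint
import Summits.AtomisticToContinuum.BoseEinsteinCondensation.Theorems.BECGroundStateSOSPeriodicIRBoundFsumExcitedPairs
import Summits.AtomisticToContinuum.BoseEinsteinCondensation.Theorems.BECGroundStateSOSPeriodicIRBoundFsumConePhaseUp
import Summits.AtomisticToContinuum.BoseEinsteinCondensation.Theorems.BECGroundStateSOSPeriodicIRBoundFsumDichotomy
import Literature.MathematicalPhysics.QuantumManyBody.TorusFockLayer
import HarnessLib

/-!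
# Crux `RichardsonAnchorBEC` (stmt-AtomisticToContinuum-14805), route `BECRichardsonGaudin`, line `registered` —
# stub `stub_condensatePairJensen`

Jensen / Cauchy–Schwarz for the condensate number operator `N₀ = a₀† a₀` of a periodic trial state `Ψ` of
`n + 2` bosons on the cell `[0,L)³`, in first quantisation (`a₀ = modeAn L (planeWaveMode L 0)`,
`a₀† = modeCr (planeWaveMode L 0)`, `Θ = a₀Ψ`, `n₀ = ‖Θ‖² = condensateOccupation (n+2) L Ψ`):

* `⟨N₀(N₀ - 1)⟩ = ‖a₀ a₀ Ψ‖² ≥ n₀² - n₀`: by the CCR `‖a₀†Θ‖² = ‖Θ‖² + ‖a₀Θ‖²` (`normSq_modeCr`, `normSq_modeAn`),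
  adjointness `Re⟨Ψ, a₀†a₀Ψ⟩ = ‖a₀Ψ‖² = n₀` (`integral_conj_mul_modeCr_modeAn`) and Cauchy–Schwarz
  `Re⟨Ψ, a₀†Θ⟩² ≤ ‖Ψ‖² ‖a₀†Θ‖²` (`innerRe_sq_le`) with `‖Ψ‖² = 1`;
* `‖a₀ a₀ Ψ‖² ≤ (n+2)(n+1)`: `‖a₀Θ‖² ≤ (n+1)‖Θ‖²` (`normSq_modeAn_le`) and `n₀ ≤ n + 2`
  (`PeriodicTrialState.cellOccupation_planeWaveMode_le`).
-/

noncomputable section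

open MeasureTheory Filter
open scoped ENNReal NNReal ComplexConjugate BigOperators

namespace Summit.AtomisticToContinuum.BoseEinsteinCondensation.Cruxes.RichardsonAnchorBEC.Birth

open Literature.MathematicalPhysics.QuantumManyBody.BoseGas
open Summit.AtomisticToContinuum.BoseEinsteinCondensation.Cruxes.PeriodicIRBound.LinearPhFloorWagner.WF
open Summit.AtomisticToContinuum.BoseEinsteinCondensation.Cruxes.PeriodicIRBound.FsumPhasePencil

/-- **Jensen for the condensate pair number** (P5): for a periodic trial state `Ψ` of `n + 2` bosons,
`n₀² ≤ ‖a₀ a₀ Ψ‖² + n₀` (i.e. `⟨N₀(N₀-1)⟩ ≥ ⟨N₀⟩² - ⟨N₀⟩`, Cauchy–Schwarz for `N₀ = a₀†a₀` on the normalised `Ψ`)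
and the trivial bound `‖a₀ a₀ Ψ‖² ≤ (n+2)(n+1)`. [folklore] -/
theorem stub_condensatePairJensen :
    ∀ (L : ℝ) (n : ℕ), 0 < L → ∀ Φ : PeriodicTrialState (n + 2) L,
      condensateOccupation (n + 2) L Φ.ψ ^ 2 ≤
          normSq L (modeAn L (planeWaveMode L 0) (modeAn L (planeWaveMode L 0) Φ.ψ)) +
            condensateOccupation (n + 2) L Φ.ψ ∧
      normSq L (modeAn L (planeWaveMode L 0) (modeAn L (planeWaveMode L 0) Φ.ψ)) ≤
          ((n + 2 : ℕ) : ℝ≥0∞) * ((n + 1 : ℕ) : ℝ≥0∞) := by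
  intro L n hL Φ
  have hΨ : IsCore L Φ.ψ := isCore_trialState Φ
  have hΘ : IsCore L (modeAn L (planeWaveMode L 0) Φ.ψ) := isCore_modeAn hL 0 hΨ
  have hΨc : Continuous Φ.ψ := hΨ.contDiff.continuous
  have hΘc : Continuous (modeAn L (planeWaveMode L 0) Φ.ψ) := hΘ.contDiff.continuous
  have hAc : Continuous (modeAn L (planeWaveMode L 0) (modeAn L (planeWaveMode L 0) Φ.ψ)) :=
    (isCore_modeAn hL 0 hΘ).contDiff.continuous
  have hCc : Continuous (modeCr (planeWaveMode L 0) (modeAn L (planeWaveMode L 0) Φ.ψ)) :=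
    (isCore_modeCr hL 0 hΘ).contDiff.continuous
  -- `n₀ = ‖a₀Ψ‖²`
  have hn0 : condensateOccupation (n + 2) L Φ.ψ = normSq L (modeAn L (planeWaveMode L 0) Φ.ψ) :=
    condensateOccupation_eq_normSq_modeAn hL Φ.ψ
  have hΘt : normSq L (modeAn L (planeWaveMode L 0) Φ.ψ) ≠ ⊤ := normSq_ne_top L hΘc
  have hAt : normSq L (modeAn L (planeWaveMode L 0) (modeAn L (planeWaveMode L 0) Φ.ψ)) ≠ ⊤ :=
    normSq_ne_top L hAc
  refine ⟨?_, ?_⟩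
  · -- (i) CCR: `‖a₀†Θ‖² = ‖Θ‖² + ‖a₀Θ‖²`
    have hCr : normSq L (modeCr (planeWaveMode L 0) (modeAn L (planeWaveMode L 0) Φ.ψ)) =
        normSq L (modeAn L (planeWaveMode L 0) Φ.ψ) +
          normSq L (modeAn L (planeWaveMode L 0) (modeAn L (planeWaveMode L 0) Φ.ψ)) := by
      rw [normSq_modeCr hL 0 hΘ, normSq_modeAn hL 0 (modeAn L (planeWaveMode L 0) Φ.ψ)]
    -- (ii) adjointness: `Re⟨Ψ, a₀†a₀Ψ⟩ = ‖a₀Ψ‖²`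
    have hinner : innerRe L Φ.ψ (modeCr (planeWaveMode L 0) (modeAn L (planeWaveMode L 0) Φ.ψ)) =
        (normSq L (modeAn L (planeWaveMode L 0) Φ.ψ)).toReal := by
      unfold innerRe
      rw [integral_conj_mul_modeCr_modeAn hL 0 hΨ, Complex.ofReal_re]
    -- Cauchy–Schwarz with `‖Ψ‖² = 1`
    have hCS := innerRe_sq_le (L := L) hΨc hCc
    have h1 : normSq L Φ.ψ = 1 := Φ.norm_eq
    rw [hinner, h1, ENNReal.toReal_one, one_mul, hCr, ENNReal.toReal_add hΘt hAt] at hCS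
    -- back to `ℝ≥0∞`
    rw [hn0, ← ENNReal.toReal_le_toReal (ENNReal.pow_ne_top hΘt) (ENNReal.add_ne_top.2 ⟨hAt, hΘt⟩),
      ENNReal.toReal_pow, ENNReal.toReal_add hAt hΘt]
    linarith
  · -- (iii) `‖a₀Θ‖² ≤ (n+1)‖Θ‖²` and `‖Θ‖² = n₀ ≤ n+2`
    have hocc : normSq L (modeAn L (planeWaveMode L 0) Φ.ψ) ≤ ((n + 2 : ℕ) : ℝ≥0∞) := by
      rw [← hn0, ← cellOccupation_planeWaveMode_zero]
      exact Φ.cellOccupation_planeWaveMode_le hL 0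
    calc normSq L (modeAn L (planeWaveMode L 0) (modeAn L (planeWaveMode L 0) Φ.ψ))
        ≤ (n + 1 : ℝ≥0∞) * normSq L (modeAn L (planeWaveMode L 0) Φ.ψ) := normSq_modeAn_le hL 0 hΘc
      _ ≤ (n + 1 : ℝ≥0∞) * ((n + 2 : ℕ) : ℝ≥0∞) := by gcongr
      _ = ((n + 2 : ℕ) : ℝ≥0∞) * ((n + 1 : ℕ) : ℝ≥0∞) := by push_cast; ring

end Summit.AtomisticToContinuum.BoseEinsteinCondensation.Cruxes.RichardsonAnchorBEC.Birth

end
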